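import Summits.BirchSwinnertonDyer.BirchSwinnertonDyer.Theorems.ByReductionTypeAtTwoMultTowerNS2LocalLayerIndex
import Literature.NumberTheory.EllipticCurves.CyclotomicZpExtension
import Literature.NumberTheory.GaloisRepresentations.LocalKroneckerWeberInertiaProofs
import HarnessLib

/-!
# Route `ByReductionTypeAtTwo`, crux `MultUpperHalfAtTwo` (item stmt-BirchSwinnertonDyer-19922), TOWER road, the
# «ONE BIT AT A NON-SPLIT 2» rows: KERNEL BRICK 13a — the local layer subgroups `H_m ≤ Γ_{ℚ_v}` of the cyclotomic
# `ℤ₂`-tower through the `2`-adic cyclotomic character: `H_m` acts on `μ_{2^{m+2}}` by `ζ ↦ ζ^{±1}`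

HONEST FRAMING (cell `bsd-2adic`, run/shared/lean/pub/bsd-2adic/, seat `bsd-2adic-tower-1` GEN 9, HUMAN RULINGS
D-0036 / D-0054 / D-0074): TOOL theorems only (no definition, no named fact, no `sorry`); closes nothing by itself;
nothing booked; BSD is not proved by any of this. Module M5 of the KERNELISATION of the displayed MEMO binder
`MultTowerNS2.localTowerKerTwoTorsion_le_two_nonsplitTwo_of_tateUnit` (scope memo HOME/tower/SCOPE-hNS2one-kernel-GEN8.md):
the local layer subgroup `H_m = localSubgroup (κ.layerSubgroup m) ℚ_v` (`v ∋ 2`, `κ` the cyclotomic `ℤ₂`-extension,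
`ker κ = χ₂⁻¹(μ(ℤ₂)) = χ₂⁻¹(±1)`) is read through the LOCAL `2`-adic cyclotomic character
`χ = GaloisRep.cyclotomicCharacter ℚ_v 2` (`χ_ℚ ∘ res_v = χ`, tree `cyclotomicCharacter_absGaloisRestrict`):

* `eq_one_or_eq_neg_one_of_isOfFinOrder` — `μ(ℤ₂) = {±1}` (from the tree's normalised logarithm `CyclotomicZp.ell`);
* `exists_cyclotomicCharacter_eq_of_mem_localSubgroup_layerSubgroup` — for `σ ∈ H_m`: `χ(σ) = ± w^{2^m}`, `w ∈ ℤ₂ˣ`;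
* `toZModPow_cyclotomicCharacter_of_mem_localSubgroup_layerSubgroup` — hence `χ(σ) ≡ ±1 (mod 2^{m+2})`;
* `smul_eq_or_eq_inv_of_mem_localSubgroup_layerSubgroup` — so `σ ζ ∈ {ζ, ζ⁻¹}` for every `2^{m+2}`-th root of
  unity `ζ ∈ K̄_v`, and `ζ + ζ⁻¹` lies in the local layer field `F_m = K̄_v^{H_m}`
  (`add_inv_mem_fixedField_localSubgroup_layerSubgroup`);
* `exists_toZModPow_cyclotomicCharacter_eq` — local surjectivity `χ(Γ_{ℚ_v}) ↠ (ℤ/2^k)ˣ` (tree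
  `adicCompletion_rat_exists_mem_absInertia_cyclotomicCharacter_eq`), and `exists_smul_eq_pow`: every `ζ^c`, `c` odd,
  is a Galois conjugate of `ζ`.

References: L. Washington, *Introduction to Cyclotomic Fields*, §13.1; J.-P. Serre, *Local Fields* IV §4 Prop. 17;
scope memo M5.
-/

set_option autoImplicit false
-- the Theorems namespace of this sub repeats the summit name by design (D-0017 nested layout: Summit.<S>.<Sub>)
set_option linter.dupNamespace false

noncomputable section

open scoped Classical

namespace Summit.BirchSwinnertonDyer.BirchSwinnertonDyer.Theorems.MultTowerNS2

open NumberField IsDedekindDomain Field PadicInt Literature.NumberTheory.EllipticCurves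
  Literature.NumberTheory.GaloisRepresentations

/-! ### `μ(ℤ₂) = {±1}` and `(ℤ₂ˣ)^{2^m} ≡ ±1 (mod 2^{m+2})` -/

/-- **The roots of unity of `ℤ₂` are `±1`**: a unit of finite order is `1` or `−1` (the normalised logarithm
`ℓ` of the tree kills it, so `u² = u^{φ(4)} = γ_cyc^{2·ℓ(u)} = 1`). [folklore] -/
theorem eq_one_or_eq_neg_one_of_isOfFinOrder {u : ℤ_[2]ˣ} (hu : IsOfFinOrder u) : u = 1 ∨ u = -1 := by
  have hell : CyclotomicZp.ell 2 u = 0 := (CyclotomicZp.ell_eq_zero_iff 2 u).mpr hu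
  have htor : Literature.NumberTheory.EllipticCurves.torsionOrder 2 = 2 := by
    simp only [Literature.NumberTheory.EllipticCurves.torsionOrder,
      Literature.NumberTheory.EllipticCurves.cyclotomicExponent, if_true]
    decide
  have h := CyclotomicZp.cycPow_torsionOrder_mul_ell 2 u
  rw [hell, mul_zero, AddChar.map_zero_eq_one, htor] at h
  have h2 : ((u : ℤ_[2]) - 1) * ((u : ℤ_[2]) + 1) = 0 := by linear_combination -h
  rcases mul_eq_zero.mp h2 with h1 | h1
  · left; exact Units.ext (sub_eq_zero.mp h1)
  · right; exact Units.ext (eq_neg_of_add_eq_zero_left h1)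

/-- Squaring raises the level: `x ≡ ±1 (mod 2^{k+2})` implies `x² ≡ 1 (mod 2^{k+3})`. [folklore] -/
theorem toZModPow_succ_sq_eq_one {k : ℕ} {x : ℤ_[2]}
    (hx : toZModPow (k + 2) x = 1 ∨ toZModPow (k + 2) x = -1) : toZModPow (k + 3) (x ^ 2) = 1 := by
  obtain ⟨s, hs, hxs⟩ : ∃ s : ℤ_[2], s ^ 2 = 1 ∧ toZModPow (k + 2) x = toZModPow (k + 2) s := by
    rcases hx with h | h
    · exact ⟨1, one_pow 2, by rw [h, map_one]⟩
    · exact ⟨-1, neg_one_sq, by rw [h, map_neg, map_one]⟩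
  have hker : x - s ∈ RingHom.ker (toZModPow (p := 2) (k + 2)) := by
    rw [RingHom.mem_ker, map_sub, hxs, sub_self]
  rw [ker_toZModPow, Ideal.mem_span_singleton] at hker
  obtain ⟨t, ht⟩ := hker
  have hx2 : x ^ 2 - 1 = (2 : ℤ_[2]) ^ (k + 3) * (s * t + 2 ^ (k + 1) * t ^ 2) := by
    have hxe : x = s + 2 ^ (k + 2) * t := by linear_combination ht
    rw [hxe]; ring_nf; rw [hs]; ring
  have hker2 : x ^ 2 - 1 ∈ RingHom.ker (toZModPow (p := 2) (k + 3)) := by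
    rw [ker_toZModPow, Ideal.mem_span_singleton, hx2]
    exact dvd_mul_right _ _
  rwa [RingHom.mem_ker, map_sub, map_one, sub_eq_zero] at hker2

/-- **`w^{2^m} ≡ ±1 (mod 2^{m+2})`** for every `2`-adic unit `w` (`≡ ±1 (mod 4)` for `m = 0`, then square).
[folklore] -/
theorem toZModPow_units_pow_two_pow (w : ℤ_[2]ˣ) (m : ℕ) :
    toZModPow (m + 2) ((w : ℤ_[2]) ^ 2 ^ m) = 1 ∨ toZModPow (m + 2) ((w : ℤ_[2]) ^ 2 ^ m) = -1 := by
  induction m with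
  | zero =>
    have hdec : ∀ a b : ZMod (2 ^ 2), a * b = 1 → a = 1 ∨ a = -1 := by decide
    have h := hdec (toZModPow 2 (w : ℤ_[2])) (toZModPow 2 ((w⁻¹ : ℤ_[2]ˣ) : ℤ_[2]))
      (by rw [← map_mul, Units.mul_inv, map_one])
    simpa using h
  | succ m ih =>
    left
    rw [pow_succ 2 m, pow_mul (w : ℤ_[2]) (2 ^ m) 2]
    exact toZModPow_succ_sq_eq_one ih

variable {κ : ZpExtension ℚ 2}

/-! ### `H_m` through the local cyclotomic character -/

/-- **`χ(σ) = ± w^{2^m}` for `σ ∈ H_m`.** For the cyclotomic `ℤ₂`-extension `κ` (`ker κ = χ₂⁻¹(μ(ℤ₂))`), the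
place `v ∋ 2` and `σ` in the local layer subgroup `H_m = res_v⁻¹(κ⁻¹(2^m ℤ₂))`: writing `κ(res σ) = 2^m · κ(τ)`,
the element `res σ · τ^{-2^m}` lies in `ker κ`, so its cyclotomic character is a root of unity of `ℤ₂`, i.e. `±1`;
and `χ_ℚ(res σ) = χ(σ)`. [cite: Washington1997, §13.1] -/
theorem exists_cyclotomicCharacter_eq_of_mem_localSubgroup_layerSubgroup (hκ : κ.IsCyclotomic)
    (v : HeightOneSpectrum (𝓞 ℚ)) {m : ℕ} {σ : absoluteGaloisGroup (v.adicCompletion ℚ)}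
    (hσ : σ ∈ localSubgroup (κ.layerSubgroup m) (v.adicCompletion ℚ)) :
    ∃ w : ℤ_[2]ˣ, GaloisRep.cyclotomicCharacter (v.adicCompletion ℚ) 2 σ = w ^ 2 ^ m ∨
      GaloisRep.cyclotomicCharacter (v.adicCompletion ℚ) 2 σ = -w ^ 2 ^ m := by
  rw [mem_localSubgroup_iff, ZpExtension.mem_layerSubgroup] at hσ
  obtain ⟨b, hb⟩ := hσ
  set ρ := resGal (K := ℚ) (v.adicCompletion ℚ) σ with hρ
  obtain ⟨τ, hτ⟩ := κ.surjective (Multiplicative.ofAdd b)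
  have hτ' : κ τ = Multiplicative.ofAdd b := hτ
  -- `ρ · (τ ^ 2^m)⁻¹ ∈ ker κ`
  have hker : ρ * (τ ^ 2 ^ m)⁻¹ ∈ κ.kerSubgroup := by
    rw [ZpExtension.mem_kerSubgroup, map_mul, map_inv, map_pow, hτ']
    apply Multiplicative.toAdd.injective
    rw [toAdd_mul, toAdd_inv, toAdd_pow, toAdd_ofAdd, hb, toAdd_one, nsmul_eq_mul]
    push_cast
    ring
  -- hence `χ_ℚ(ρ τ^{-2^m})` has finite order, i.e. is `±1`
  unfold ZpExtension.IsCyclotomic at hκ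
  rw [hκ, Subgroup.mem_comap, CommGroup.mem_torsion] at hker
  have hpm := eq_one_or_eq_neg_one_of_isOfFinOrder hker
  have hres : GaloisRep.cyclotomicCharacter ℚ 2 ρ = GaloisRep.cyclotomicCharacter (v.adicCompletion ℚ) 2 σ :=
    cyclotomicCharacter_absGaloisRestrict ℚ (v.adicCompletion ℚ) 2 σ
  refine ⟨GaloisRep.cyclotomicCharacter ℚ 2 τ, ?_⟩
  change (GaloisRep.cyclotomicCharacter ℚ 2).toMonoidHom (ρ * (τ ^ 2 ^ m)⁻¹) = 1 ∨
    (GaloisRep.cyclotomicCharacter ℚ 2).toMonoidHom (ρ * (τ ^ 2 ^ m)⁻¹) = -1 at hpm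
  rw [map_mul, map_inv, map_pow, mul_inv_eq_iff_eq_mul, mul_inv_eq_iff_eq_mul, one_mul] at hpm
  change GaloisRep.cyclotomicCharacter ℚ 2 ρ = GaloisRep.cyclotomicCharacter ℚ 2 τ ^ 2 ^ m ∨
    GaloisRep.cyclotomicCharacter ℚ 2 ρ = -1 * GaloisRep.cyclotomicCharacter ℚ 2 τ ^ 2 ^ m at hpm
  rw [hres, neg_one_mul] at hpm
  exact hpm

/-- **`χ(σ) ≡ ±1 (mod 2^{m+2})` for `σ ∈ H_m`** (`χ(σ) = ±w^{2^m}` and `w^{2^m} ≡ ±1`). [cite: Washington1997, §13.1] -/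
theorem toZModPow_cyclotomicCharacter_of_mem_localSubgroup_layerSubgroup (hκ : κ.IsCyclotomic)
    (v : HeightOneSpectrum (𝓞 ℚ)) {m : ℕ} {σ : absoluteGaloisGroup (v.adicCompletion ℚ)}
    (hσ : σ ∈ localSubgroup (κ.layerSubgroup m) (v.adicCompletion ℚ)) :
    toZModPow (m + 2) ((GaloisRep.cyclotomicCharacter (v.adicCompletion ℚ) 2 σ : ℤ_[2]ˣ) : ℤ_[2]) = 1 ∨
      toZModPow (m + 2) ((GaloisRep.cyclotomicCharacter (v.adicCompletion ℚ) 2 σ : ℤ_[2]ˣ) : ℤ_[2]) = -1 := by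
  obtain ⟨w, hw⟩ := exists_cyclotomicCharacter_eq_of_mem_localSubgroup_layerSubgroup hκ v hσ
  have hw2 := toZModPow_units_pow_two_pow w m
  rcases hw with h | h <;> rw [h]
  · simpa [Units.val_pow_eq_pow_val] using hw2
  · rw [Units.val_neg, map_neg, Units.val_pow_eq_pow_val]
    rcases hw2 with h2 | h2 <;> rw [h2]
    · right; rfl
    · left; rw [neg_neg]

/-- **`H_m` acts on `μ_{2^{m+2}}(K̄_v)` by `ζ ↦ ζ^{±1}`**: for `σ ∈ H_m` and `ζ ∈ K̄_v` with `ζ^{2^{m+2}} = 1`,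
`σ ζ = ζ` or `σ ζ = ζ⁻¹`. [cite: Washington1997, §13.1] -/
theorem smul_eq_or_eq_inv_of_mem_localSubgroup_layerSubgroup (hκ : κ.IsCyclotomic)
    (v : HeightOneSpectrum (𝓞 ℚ)) {m : ℕ} {σ : absoluteGaloisGroup (v.adicCompletion ℚ)}
    (hσ : σ ∈ localSubgroup (κ.layerSubgroup m) (v.adicCompletion ℚ))
    {ζ : AlgebraicClosure (v.adicCompletion ℚ)} (hζ : ζ ^ 2 ^ (m + 2) = 1) :
    σ • ζ = ζ ∨ σ • ζ = ζ⁻¹ := by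
  haveI : CharZero (v.adicCompletion ℚ) :=
    charZero_of_injective_algebraMap (algebraMap ℚ (v.adicCompletion ℚ)).injective
  haveI : NeZero ((2 : ℕ) : v.adicCompletion ℚ) := ⟨by norm_num⟩
  have hspec := GaloisRep.cyclotomicCharacter_spec (v.adicCompletion ℚ) 2 (k := m + 2) σ ζ hζ
  have hζu : IsUnit ζ := IsUnit.of_pow_eq_one hζ (pow_ne_zero _ two_ne_zero)
  haveI : Fact (1 < 2 ^ (m + 2)) := ⟨Nat.one_lt_pow (by omega) (by norm_num)⟩
  rcases toZModPow_cyclotomicCharacter_of_mem_localSubgroup_layerSubgroup hκ v hσ with h | h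
  · left
    rw [hspec, h, ZMod.val_one, pow_one]
  · right
    have hval : (-1 : ZMod (2 ^ (m + 2))).val = 2 ^ (m + 2) - 1 := by
      rw [ZMod.neg_val, if_neg one_ne_zero, ZMod.val_one]
    rw [hspec, h, hval, ← mul_right_inj' hζu.ne_zero]
    rw [← pow_succ', Nat.sub_add_cancel (Nat.one_le_two_pow), hζ, mul_inv_cancel₀ hζu.ne_zero]

/-- **`y_m = ζ + ζ⁻¹ ∈ F_m`**: for every `2^{m+2}`-th root of unity `ζ ∈ K̄_v`, the element `ζ + ζ⁻¹` lies in the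
fixed field `F_m = K̄_v^{H_m}` of the `m`-th local layer subgroup (the local layer field `ℚ_v(ζ_{2^{m+2}})⁺`).
[cite: Washington1997, §13.1] -/
theorem add_inv_mem_fixedField_localSubgroup_layerSubgroup (hκ : κ.IsCyclotomic)
    (v : HeightOneSpectrum (𝓞 ℚ)) (m : ℕ) {ζ : AlgebraicClosure (v.adicCompletion ℚ)}
    (hζ : ζ ^ 2 ^ (m + 2) = 1) :
    ζ + ζ⁻¹ ∈ IntermediateField.fixedField (localSubgroup (κ.layerSubgroup m) (v.adicCompletion ℚ)) := by
  rw [IntermediateField.mem_fixedField_iff]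
  intro σ hσ
  rw [map_add, map_inv₀]
  rcases smul_eq_or_eq_inv_of_mem_localSubgroup_layerSubgroup hκ v hσ hζ with h | h
  · have h' : σ ζ = ζ := h
    rw [h']
  · have h' : σ ζ = ζ⁻¹ := h
    rw [h', inv_inv, add_comm]

/-! ### Local surjectivity of the cyclotomic character modulo `2^k` -/

/-- **Every odd residue is a local cyclotomic character**: for `v ∋ 2` and a unit `c` of `ℤ/2^k`, some
`σ ∈ Γ_{ℚ_v}` has `χ(σ) ≡ c (mod 2^k)` (the tree's `χ₂(I_{ℚ_v}) = ℤ₂ˣ`,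
`adicCompletion_rat_exists_mem_absInertia_cyclotomicCharacter_eq`, at a unit of `ℤ₂` lifting `c`).
[cite: SerreLocalFields1979, Ch. IV §4 Prop. 17] -/
theorem exists_toZModPow_cyclotomicCharacter_eq (v : HeightOneSpectrum (𝓞 ℚ))
    (hv : ((2 : ℕ) : 𝓞 ℚ) ∈ v.asIdeal) (k : ℕ) (c : (ZMod (2 ^ k))ˣ) :
    ∃ σ : absoluteGaloisGroup (v.adicCompletion ℚ),
      toZModPow k ((GaloisRep.cyclotomicCharacter (v.adicCompletion ℚ) 2 σ : ℤ_[2]ˣ) : ℤ_[2]) = c := by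
  have hv' : (Rat.HeightOneSpectrum.primesEquiv v : ℕ) = 2 := by
    have h1 : Rat.HeightOneSpectrum.natGenerator v ∣ 2 := by
      rw [Rat.HeightOneSpectrum.natGenerator_dvd_iff, Ideal.mem_map_of_equiv]
      exact ⟨2, hv, map_natCast _ 2⟩
    exact (Nat.prime_dvd_prime_iff_eq (Rat.HeightOneSpectrum.prime_natGenerator v) Nat.prime_two).mp h1
  -- a `2`-adic unit lifting `c`
  obtain ⟨u, hu⟩ : ∃ u : ℤ_[2]ˣ, toZModPow k (u : ℤ_[2]) = c := by
    rcases Nat.eq_zero_or_pos k with rfl | hk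
    · haveI : Subsingleton (ZMod (2 ^ 0)) := inferInstanceAs (Subsingleton (ZMod 1))
      exact ⟨1, Subsingleton.elim _ _⟩
    set n : ℕ := (c : ZMod (2 ^ k)).val with hn
    have hnodd : ¬ 2 ∣ n := by
      intro hd
      have hcu : IsUnit ((n : ZMod (2 ^ k))) := by rw [hn, ZMod.natCast_zmod_val]; exact c.isUnit
      obtain ⟨e, he⟩ := hd
      rw [he, Nat.cast_mul, Nat.cast_ofNat] at hcu
      have h2 : ¬ IsUnit ((2 : ZMod (2 ^ k))) := by
        rw [show (2 : ZMod (2 ^ k)) = ((2 : ℕ) : ZMod (2 ^ k)) by norm_cast, ZMod.isUnit_iff_coprime,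
          Nat.coprime_pow_right_iff hk, Nat.coprime_self]
        norm_num
      exact h2 (isUnit_of_mul_isUnit_left hcu)
    have hun : IsUnit ((n : ℤ) : ℤ_[2]) := by
      rw [PadicInt.isUnit_iff]
      refine le_antisymm (PadicInt.norm_le_one _) ?_
      by_contra hlt
      rw [not_le, PadicInt.norm_int_lt_one_iff_dvd] at hlt
      exact hnodd (by exact_mod_cast hlt)
    refine ⟨hun.unit, ?_⟩
    rw [IsUnit.unit_spec, map_intCast, Int.cast_natCast, hn, ZMod.natCast_zmod_val]
  obtain ⟨σ, -, hσ⟩ := adicCompletion_rat_exists_mem_absInertia_cyclotomicCharacter_eq (p := 2) (v := v) hv' u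
  exact ⟨σ, by rw [hσ, hu]⟩

/-- **Every `ζ^c`, `c` odd, is a conjugate of `ζ`**: for `v ∋ 2`, `ζ ∈ K̄_v` with `ζ^{2^k} = 1` and a unit `c` of
`ℤ/2^k`, some `σ ∈ Γ_{ℚ_v}` has `σ ζ = ζ^{c}`. [cite: SerreLocalFields1979, Ch. IV §4 Prop. 17] -/
theorem exists_smul_eq_pow (v : HeightOneSpectrum (𝓞 ℚ)) (hv : ((2 : ℕ) : 𝓞 ℚ) ∈ v.asIdeal) (k : ℕ)
    (c : (ZMod (2 ^ k))ˣ) {ζ : AlgebraicClosure (v.adicCompletion ℚ)} (hζ : ζ ^ 2 ^ k = 1) :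
    ∃ σ : absoluteGaloisGroup (v.adicCompletion ℚ), σ • ζ = ζ ^ (c : ZMod (2 ^ k)).val := by
  haveI : CharZero (v.adicCompletion ℚ) :=
    charZero_of_injective_algebraMap (algebraMap ℚ (v.adicCompletion ℚ)).injective
  haveI : NeZero ((2 : ℕ) : v.adicCompletion ℚ) := ⟨by norm_num⟩
  obtain ⟨σ, hσ⟩ := exists_toZModPow_cyclotomicCharacter_eq v hv k c
  refine ⟨σ, ?_⟩
  rw [GaloisRep.cyclotomicCharacter_spec (v.adicCompletion ℚ) 2 (k := k) σ ζ hζ, hσ]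

end Summit.BirchSwinnertonDyer.BirchSwinnertonDyer.Theorems.MultTowerNS2

end
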